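import Summits.Schanuel.Schanuel.Theorems.RootDecomp1KHyper16

/-!
# RootDecomp1KHyper — part 17 of the «HyperCarving» port wave (lens 6, gen 9 = ROUND 4 of route-Schanuel-RootDecomp1K; 19 parts planned)

Mechanical port (census-1 gen 7, dependency closure; tools census/tools/gen7/portkit2.py + build_l6g9.py) of §17 of HOME/decomp-schanuel-lens-6/g9/HyperCarving.lean
(sha256 aba5c91f…, 8041 l; critic CLEARED FOR TYPING 2026-08-30T13:33:07Z; writer PATH A″ rev 5–8) together with the §§0–16 declarations it depends on
(nothing of the node was in the tree before except RootDecomp1KLinLiouvilleSplit and the Literature fact NesterenkoWaldschmidt1996_thm_5_1).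
This part: node lines 7063–7388 (19 declarations: no_int_relation_of_weakMeasure_hyperLiouville, algebraicIndependent_of_weakMeasure_hyperLiouville, sb_two_of_hyperLinLiouville_of_weakMeasure, DarkHyperPairSchanuel, DarkWeakMeasure, darkWeakMeasure_of_expCurveMahler …).
All parts share the namespace `Summit.Schanuel.Schanuel.Theorems.RootDecomp1KHyper` (node sub-namespace `HyperCell` reproduced); statements and proofs
are the node's verbatim; `--supports stmt-Schanuel-33363` (A₄ʰ HyperLiouvilleSchanuel). Sorry-free; standard axioms. Nothing here proves Schanuel; rung 0.
-/

set_option linter.dupNamespace false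
set_option linter.unusedSectionVars false

noncomputable section

open Complex IntermediateField Filter Polynomial
open Literature.Uncategorized (W78LogMeasure)

namespace Summit.Schanuel.Schanuel.Theorems.RootDecomp1KHyper

variable {n K : ℕ}

namespace HyperCell

variable {n K : ℕ}

/-- `exp(−x) ≤ 1/x` for `x > 0`. -/
private theorem exp_neg_le_one_div {x : ℝ} (hx : 0 < x) : Real.exp (-x) ≤ 1 / x := by
  rw [Real.exp_neg, ← one_div]
  exact one_div_le_one_div_of_le hx (by linarith [Real.add_one_le_exp x])

/-- **Hyper-Liouville extraction against a WEAK measure (kernel; the round-4 engine).**  No relation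
`Σ_{k ≤ K} G_k(θ) ρ^k = 0` with integer polynomials `G_k`, not all zero, holds between a number `θ`
with a `WeakMeasure` and a HYPER-Liouville real `ρ`: specialise `Y := p/q` at an approximation
`|ρ − p/q| < exp(−q^m)`, `m = K·k + K + 1`; the measure bounds `|q^K P(θ, p/q)|` BELOW by
`exp(−C (C_q q^K)^k)`, the Lipschitz estimate bounds it ABOVE by `q^K M exp(−q^m)`; for `q` large
the two are incompatible.  Same bookkeeping as §7a, exponential budget instead of polynomial. -/
theorem no_int_relation_of_weakMeasure_hyperLiouville {θ : ℂ} (hθ : WeakMeasure θ) {ρ : ℝ}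
    (hρ : HyperLiouville ρ) {K : ℕ} (G : Fin (K + 1) → ℤ[X]) (hG : ∃ k, G k ≠ 0)
    (hrel : ∑ k : Fin (K + 1), aeval θ (G k) * (ρ : ℂ) ^ (k : ℕ) = 0) : False := by
  -- the complex polynomial μ(Y) = Σ_k G_k(θ) Y^k
  set μ : ℂ[X] := ∑ k : Fin (K + 1), C (aeval θ (G k)) * X ^ (k : ℕ) with hμdef
  have hμeval : ∀ y : ℂ, μ.eval y = ∑ k : Fin (K + 1), aeval θ (G k) * y ^ (k : ℕ) := by
    intro y
    simp only [hμdef, eval_finsetSum, eval_mul, eval_C, eval_pow, eval_X]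
  have hμcoeff : ∀ k : Fin (K + 1), μ.coeff k = aeval θ (G k) := by
    intro k
    simp only [hμdef, finsetSum_coeff, coeff_C_mul, coeff_X_pow]
    rw [Finset.sum_eq_single k]
    · simp
    · intro j _ hjk
      have : (k : ℕ) ≠ (j : ℕ) := fun h => hjk (Fin.ext h).symm
      simp [this]
    · intro h; exact absurd (Finset.mem_univ k) h
  have hμ0 : μ ≠ 0 := by
    obtain ⟨k, hk⟩ := hG
    intro h0
    have h1 : μ.coeff k = 0 := by rw [h0, coeff_zero]
    rw [hμcoeff] at h1
    exact aeval_ne_zero_of_weakMeasure hθ hk h1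
  have hroot : μ.eval (ρ : ℂ) = 0 := by rw [hμeval]; exact hrel
  obtain ⟨δ, hδ, hδroot⟩ := exists_ball_eval_ne_zero μ hμ0 ρ
  obtain ⟨M, hM, hLip⟩ := exists_lipschitz_at_root μ ρ hroot
  -- sizes
  set D : ℕ := Finset.univ.sup fun k : Fin (K + 1) => (G k).natDegree with hDdef
  have hD : ∀ k, (G k).natDegree ≤ D := fun k =>
    Finset.le_sup (f := fun k : Fin (K + 1) => (G k).natDegree) (Finset.mem_univ k)
  -- the measure in degree D
  obtain ⟨Cm, kk, hCm, hmeas⟩ := hθ D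
  set Λ : ℤ := ∑ k : Fin (K + 1), ∑ i ∈ Finset.range (D + 1), |(G k).coeff i| with hΛ
  have hΛ0 : 0 ≤ Λ := Finset.sum_nonneg fun _ _ => Finset.sum_nonneg fun _ _ => abs_nonneg _
  set A : ℕ := ⌈|ρ|⌉₊ + 2 with hA
  set Cq : ℕ := Λ.toNat * A ^ K + 3 with hCq
  set m : ℕ := K * kk + K + 1 with hm
  set Q₀ : ℝ := Cm * (Cq : ℝ) ^ kk + M + δ⁻¹ + 2 with hQ₀
  -- a hyper-Liouville approximation with a large denominator
  obtain ⟨r, hden, hne, hlt⟩ := hρ (max m (⌈Q₀⌉₊ + 1))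
  set q : ℕ := r.den with hq
  set p : ℤ := r.num with hp
  have hMCE : 0 ≤ Cm * (Cq : ℝ) ^ kk := by positivity
  have hδinv : 0 < δ⁻¹ := inv_pos.mpr hδ
  have hqQ : Q₀ < q := by
    have h1 : ⌈Q₀⌉₊ + 1 ≤ q := (le_max_right _ _).trans hden
    have h2 : Q₀ ≤ ⌈Q₀⌉₊ := Nat.le_ceil _
    have h3 : ((⌈Q₀⌉₊ + 1 : ℕ) : ℝ) ≤ q := by exact_mod_cast h1
    push_cast at h3
    linarith
  have hq2 : (2 : ℝ) < q := by
    have : (2 : ℝ) ≤ Q₀ := by rw [hQ₀]; linarith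
    linarith
  have hq1 : (1 : ℝ) < q := by linarith
  have hqpos : (0 : ℝ) < q := by linarith
  have hqR : (q : ℝ) ≠ 0 := hqpos.ne'
  have hq0 : q ≠ 0 := by rintro h; rw [h] at hqpos; simp at hqpos
  have hqinvδ : (q : ℝ)⁻¹ < δ := by
    have h1 : δ⁻¹ < q := by rw [hQ₀] at hqQ; linarith
    exact (inv_lt_comm₀ hδ hqpos).mp h1
  -- x := r = p/q as a real number
  set x : ℝ := (r : ℝ) with hx
  have hxpq : x = (p : ℝ) / q := by rw [hx, hp, hq]; exact Rat.cast_def r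
  have hxρ : |x - ρ| < Real.exp (-(q : ℝ) ^ m) := by
    rw [abs_sub_comm]
    refine hlt.trans_le (Real.exp_le_exp.mpr (neg_le_neg ?_))
    exact pow_le_pow_right₀ hq1.le (le_max_left _ _)
  have hqm1 : Real.exp (-(q : ℝ) ^ m) ≤ (q : ℝ)⁻¹ := by
    have h1 : (q : ℝ) ≤ (q : ℝ) ^ m := le_self_pow₀ hq1.le (by omega)
    calc Real.exp (-(q : ℝ) ^ m) ≤ Real.exp (-(q : ℝ)) := Real.exp_le_exp.mpr (by linarith)
      _ ≤ 1 / (q : ℝ) := exp_neg_le_one_div hqpos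
      _ = (q : ℝ)⁻¹ := one_div _
  have hxρ1 : |x - ρ| ≤ 1 := by
    have : (q : ℝ)⁻¹ ≤ 1 := inv_le_one_of_one_le₀ hq1.le
    linarith
  have hxρδ : |x - ρ| < δ := by linarith
  have hxne : x ≠ ρ := fun h => hne (by rw [← h])
  -- (1) μ(x) ≠ 0
  have hμx : μ.eval (x : ℂ) ≠ 0 := hδroot x hxne hxρδ
  -- (2) the integer polynomial H = q^K P(X, p/q) and its value at θ
  set H : ℤ[X] := specialise G p q with hH
  have hxC : ((x : ℝ) : ℂ) = (p : ℂ) / (q : ℂ) := by rw [hxpq]; push_cast; rfl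
  have hHe : aeval θ H = (q : ℂ) ^ K * μ.eval (x : ℂ) := by
    rw [hH, aeval_specialise G p hq0, hμeval, hxC]
  have hqC : (q : ℂ) ≠ 0 := by exact_mod_cast hq0
  have hH0 : H ≠ 0 := by
    intro h0
    have : (q : ℂ) ^ K * μ.eval (x : ℂ) = 0 := by rw [← hHe, h0, map_zero]
    rcases mul_eq_zero.mp this with h | h
    · exact pow_ne_zero K hqC h
    · exact hμx h
  -- (3) upper bound
  have hup : ‖aeval θ H‖ < (q : ℝ) ^ K * M * Real.exp (-(q : ℝ) ^ m) := by
    rw [hHe, norm_mul, norm_pow, Complex.norm_natCast]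
    calc (q : ℝ) ^ K * ‖μ.eval (x : ℂ)‖ ≤ (q : ℝ) ^ K * (M * |x - ρ|) := by
          gcongr; exact hLip x hxρ1
      _ < (q : ℝ) ^ K * (M * Real.exp (-(q : ℝ) ^ m)) := by gcongr
      _ = _ := by ring
  -- (4) the length of H
  have hdegH : H.natDegree ≤ D := natDegree_specialise_le G p q hD
  have hpq_bound : (|p| : ℤ) + q ≤ (A : ℤ) * q := by
    have h2 : |(p : ℝ) / q| ≤ |ρ| + 1 := by
      calc |(p : ℝ) / q| = |(x - ρ) + ρ| := by rw [hxpq]; ring_nf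
        _ ≤ |x - ρ| + |ρ| := abs_add_le _ _
        _ ≤ |ρ| + 1 := by linarith
    rw [abs_div, abs_of_pos hqpos, div_le_iff₀ hqpos] at h2
    have h3 : |ρ| ≤ ⌈|ρ|⌉₊ := Nat.le_ceil _
    have h4a : (|ρ| + 1) * (q : ℝ) ≤ ((⌈|ρ|⌉₊ : ℝ) + 1) * q :=
      mul_le_mul_of_nonneg_right (by linarith) hqpos.le
    have h4 : |(p : ℝ)| + q ≤ ((⌈|ρ|⌉₊ : ℝ) + 2) * q := by linarith
    have h5 : (((|p| + q : ℤ)) : ℝ) ≤ (((A : ℤ) * q : ℤ) : ℝ) := by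
      rw [hA]; push_cast; linarith
    exact_mod_cast h5
  have hpq0 : (0 : ℤ) ≤ |p| + q := by positivity
  have hlenH : len H ≤ ((Cq * q ^ K : ℕ) : ℤ) := by
    calc len H ≤ (|p| + q) ^ K * Λ := len_specialise_le G p q hD
      _ ≤ ((A : ℤ) * q) ^ K * Λ := by gcongr
      _ = (A : ℤ) ^ K * (q : ℤ) ^ K * Λ := by ring
      _ ≤ (A : ℤ) ^ K * (q : ℤ) ^ K * Λ.toNat + 3 * (q : ℤ) ^ K := by
          have h1 : Λ ≤ Λ.toNat := Int.self_le_toNat Λ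
          have h2 : (0 : ℤ) ≤ (A : ℤ) ^ K * (q : ℤ) ^ K := by positivity
          have h3 : (0 : ℤ) ≤ 3 * (q : ℤ) ^ K := by positivity
          exact le_add_of_le_of_nonneg (mul_le_mul_of_nonneg_left h1 h2) h3
      _ = ((Cq * q ^ K : ℕ) : ℤ) := by rw [hCq]; push_cast; ring
  have hlenR : ((len H : ℤ) : ℝ) ≤ (Cq : ℝ) * (q : ℝ) ^ K := by
    have h1 : (((len H : ℤ)) : ℝ) ≤ (((Cq * q ^ K : ℕ) : ℤ) : ℝ) := by exact_mod_cast hlenH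
    have h2 : (((Cq * q ^ K : ℕ) : ℤ) : ℝ) = (Cq : ℝ) * (q : ℝ) ^ K := by push_cast; ring
    rw [← h2]; exact h1
  have hlen0 : (0 : ℝ) ≤ ((len H : ℤ) : ℝ) := by exact_mod_cast len_nonneg H
  -- (5) the lower bound of the measure
  have hlow : Real.exp (-(Cm * ((len H : ℤ) : ℝ) ^ kk)) ≤ ‖aeval θ H‖ := hmeas H hH0 hdegH
  have hlow' : Real.exp (-(Cm * ((Cq : ℝ) * (q : ℝ) ^ K) ^ kk)) ≤ ‖aeval θ H‖ := by
    refine le_trans (Real.exp_le_exp.mpr (neg_le_neg ?_)) hlow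
    gcongr
  -- (6) the clash: exp(−Cm (Cq q^K)^kk) < q^K M exp(−q^m) is impossible for q ≥ Q₀
  have hchain := hlow'.trans_lt hup
  set a : ℝ := (q : ℝ) ^ K with ha
  set b : ℝ := (q : ℝ) ^ (K * kk) with hb
  have ha1 : 1 ≤ a := one_le_pow₀ hq1.le
  have hb1 : 1 ≤ b := one_le_pow₀ hq1.le
  have hab1 : 1 ≤ a * b := one_le_mul_of_one_le_of_one_le ha1 hb1
  have hpowk : ((Cq : ℝ) * (q : ℝ) ^ K) ^ kk = (Cq : ℝ) ^ kk * b := by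
    rw [mul_pow, ← pow_mul]
  have hqm : (q : ℝ) ^ m = b * a * q := by rw [hm]; ring
  have hqge : Cm * (Cq : ℝ) ^ kk + M + 2 ≤ q := by rw [hQ₀] at hqQ; linarith
  have hE : Cm * (Cq : ℝ) ^ kk * b + (a * M + 1) ≤ (q : ℝ) ^ m := by
    rw [hqm]
    have h1 : Cm * (Cq : ℝ) ^ kk * b ≤ Cm * (Cq : ℝ) ^ kk * (a * b) := by
      apply mul_le_mul_of_nonneg_left _ hMCE
      calc b = 1 * b := (one_mul b).symm
        _ ≤ a * b := by gcongr
    have h2 : a * M ≤ M * (a * b) := by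
      calc a * M = M * (a * 1) := by ring
        _ ≤ M * (a * b) := by gcongr
    have h3 : (1 : ℝ) ≤ 2 * (a * b) := by linarith
    have h4 : (Cm * (Cq : ℝ) ^ kk + M + 2) * (a * b) ≤ (q : ℝ) * (a * b) :=
      mul_le_mul_of_nonneg_right hqge (by positivity)
    nlinarith
  have h1 : a * M * Real.exp (-(q : ℝ) ^ m) ≤ Real.exp (-(Cm * ((Cq : ℝ) * (q : ℝ) ^ K) ^ kk)) := by
    rw [hpowk, ← mul_assoc]
    have h3 : Real.exp (-(q : ℝ) ^ m) ≤
        Real.exp (-(a * M + 1)) * Real.exp (-(Cm * (Cq : ℝ) ^ kk * b)) := by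
      rw [← Real.exp_add]; exact Real.exp_le_exp.mpr (by linarith)
    have h4 : a * M * Real.exp (-(a * M + 1)) ≤ 1 := by
      have h5 := Real.add_one_le_exp (a * M + 1)
      rw [Real.exp_neg, mul_inv_le_iff₀ (Real.exp_pos _)]
      linarith
    have haM : 0 ≤ a * M := by positivity
    calc a * M * Real.exp (-(q : ℝ) ^ m)
        ≤ a * M * (Real.exp (-(a * M + 1)) * Real.exp (-(Cm * (Cq : ℝ) ^ kk * b))) :=
          mul_le_mul_of_nonneg_left h3 haM
      _ = (a * M * Real.exp (-(a * M + 1))) * Real.exp (-(Cm * (Cq : ℝ) ^ kk * b)) := by ring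
      _ ≤ 1 * Real.exp (-(Cm * (Cq : ℝ) ^ kk * b)) := by gcongr
      _ = _ := one_mul _
  exact absurd hchain (not_lt.mpr h1)

/-- **Weak class principle (kernel).** A number with a weak transcendence measure in every degree
and a hyper-Liouville real are algebraically independent over `ℚ`. -/
theorem algebraicIndependent_of_weakMeasure_hyperLiouville {θ : ℂ} (hθ : WeakMeasure θ) {ρ : ℝ}
    (hρ : HyperLiouville ρ) : AlgebraicIndependent ℚ ![θ, (ρ : ℂ)] := by
  by_contra h
  obtain ⟨K, G, hGK, hrel⟩ := exists_int_relation (transcendental_of_weakMeasure hθ) h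
  exact no_int_relation_of_weakMeasure_hyperLiouville hθ hρ G ⟨Fin.last K, hGK⟩ hrel

/-- **MASTER CELL, round 4.** A ℚ-free HYPER-Liouville pair has Schanuel's bound as soon as SOME
element of `ℚ(z, e^z, i)` has a WEAK measure (round 3's `sb_two_of_linLiouville_of_polyMeasure`
with `PolyMeasure` weakened to `WeakMeasure` and `LinLiouville` strengthened to `HyperLinLiouville`). -/
theorem sb_two_of_hyperLinLiouville_of_weakMeasure {θ : ℂ} (hθ : WeakMeasure θ) {z : Fin 2 → ℂ}
    (hz : LinearIndependent ℚ z) (hH : HyperLinLiouville z)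
    (hθz : θ ∈ adjoin ℚ (SFset z ∪ {I})) : SB 2 z := by
  obtain ⟨ρ, hρ, h1⟩ := exists_hyperLiouville_ratio_of_hyperLinLiouville hz hH
  have hz0 : z 0 ≠ 0 := hz.ne_zero 0
  have hρmem : (ρ : ℂ) ∈ adjoin ℚ (SFset z ∪ {I}) := by
    have : (ρ : ℂ) = z 1 / z 0 := by rw [h1, mul_div_assoc, div_self hz0, mul_one]
    rw [this]; exact ratio_mem_adjoin z
  exact sb_two_of_algebraicIndependent (algebraicIndependent_of_weakMeasure_hyperLiouville hθ hρ)
    hθz hρmem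

/-- **Schanuel at the DARK HYPER pairs** — the level-2 storey of A₄ʰ in closed form: for `t`
transcendental with `e^t` transcendental, `t, e^t` algebraically DEPENDENT, `t ∉ ℝ·(hyper-Liouville)`,
and `ρ` hyper-Liouville, `trdeg ℚ(t, ρt, e^t, e^{ρt}) ≥ 2`.  (The excluded cases are decided:
§13 cells and §16f.) -/
def DarkHyperPairSchanuel : Prop :=
  ∀ (t : ℂ) (ρ : ℝ), HyperLiouville ρ → Transcendental ℚ t → Transcendental ℚ (cexp t) →
    ¬ AlgebraicIndependent ℚ ![t, cexp t] → ¬ (t.im = 0 ∧ HyperLiouville t.re) →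
    (2 : Cardinal) ≤ Algebra.trdeg ℚ ↥(IntermediateField.adjoin ℚ
      (Set.range ![t, (ρ : ℂ) * t] ∪ Set.range (cexp ∘ ![t, (ρ : ℂ) * t])))

/-- **Weak measures at the exponential-algebraic points** (the INSTRUMENTABLE leaf of round 4):
a transcendental `t` with `e^t` transcendental and `t, e^t` algebraically dependent has a
`WeakMeasure`.  In print modulo bookkeeping: Nesterenko–Waldschmidt (1996) bound
`|θ − α| + |e^θ − β| ≥ exp(−c·d²(log H)(…))` simultaneously for algebraic `α, β` of degree `≤ d`,
height `≤ H`; at a point of the curve `Q(t, e^t) = 0` a small value `|P(t)|` forces `t` close to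
a root `α` of `P` and then `e^t` close to a root `β` of `Q(α, ·)`, of controlled degree and height
(root-closeness + resultant lemma) — giving `|P(t)| ≥ exp(−C_d (log len P)^{κ})`, far more than
`WeakMeasure` asks.  Compare `ExpCurveMahler` (round 3, IDEA-NEEDED): a POLYNOMIAL measure at the
same points, which no simultaneous measure in print delivers. -/
def DarkWeakMeasure : Prop :=
  ∀ t : ℂ, Transcendental ℚ t → Transcendental ℚ (cexp t) → ¬ AlgebraicIndependent ℚ ![t, cexp t] →
    WeakMeasure t

/-- `ExpCurveMahler ⇒ DarkWeakMeasure` (a polynomial measure is a weak one): the round-4 leaf is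
implied by the round-3 leaf, not conversely. -/
theorem darkWeakMeasure_of_expCurveMahler (h : ExpCurveMahler) : DarkWeakMeasure :=
  fun t ht he hai => PolyMeasure.weakMeasure (h t ht he hai)

/-- `DarkWeakMeasure ⇒ DarkHyperPairSchanuel` (kernel, by the master cell). -/
theorem darkHyper_of_darkWeakMeasure (h : DarkWeakMeasure) : DarkHyperPairSchanuel := by
  intro t ρ hρ ht he hai _
  have ht0 : t ≠ 0 := transcendental_ne_zero ht
  have hsc := hyperPair_scope ht0 hρ
  exact sb_two_of_hyperLinLiouville_of_weakMeasure (h t ht he hai) hsc.1 hsc.2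
    (mem_adjoin_SFset_I (Or.inl ⟨0, by simp⟩))

/-- `DarkLiouvillePairSchanuel ⇒ DarkHyperPairSchanuel` (hyper-Liouville reals are Liouville):
the dark storey of A₄ʰ is implied by the dark storey of A₃. -/
theorem darkHyper_of_darkLiouville (h : DarkLiouvillePairSchanuel) : DarkHyperPairSchanuel :=
  fun t ρ hρ ht he hai _ => h t ρ hρ.liouville ht he hai

/-- **Level 2 of A₄ʰ from the dark hyper pairs** (mod the PROVED measures `hW`, `hlm` and the
printed `hX`): case analysis of a ℚ-free hyper-Liouville pair `z = (t, ρt)`. -/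
theorem hyperLiouvilleSchanuel_two_of_darkHyper (hW : WMeasure) (hlm : W78LogMeasure)
    (hX : ExplicitRatExpApprox) (hD : DarkHyperPairSchanuel) (z : Fin 2 → ℂ)
    (hz : LinearIndependent ℚ z) (hH : HyperLinLiouville z) : SB 2 z := by
  have hL : LinLiouville z := hH.linLiouville
  by_cases hβ : IsAlgebraic ℚ (z 0)
  · exact cell₃_exp_algebraic hW hz hL 0 hβ
  by_cases hα : IsAlgebraic ℚ (cexp (z 0))
  · exact cell₃_log hlm hz hL 0 hα
  by_cases hai : AlgebraicIndependent ℚ ![z 0, cexp (z 0)]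
  · exact sb_two_of_algebraicIndependent_exp 0 hai
  by_cases hre : (z 0).im = 0 ∧ HyperLiouville (z 0).re
  · exact sb_two_of_hyperLiouville_coord hX 0 hre.1 hre.2
  obtain ⟨ρ, hρ, h1⟩ := exists_hyperLiouville_ratio_of_hyperLinLiouville hz hH
  have ez : z = ![z 0, (ρ : ℂ) * z 0] := by
    ext i; fin_cases i
    · rfl
    · exact h1
  rw [ez]
  exact hD (z 0) ρ hρ hβ hα hai hre

/-- Conversely the dark hyper pairs are instances of level 2 of A₄ʰ (hypothesis-free). -/
theorem darkHyper_of_hyperLiouvilleSchanuel_two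
    (h : ∀ z : Fin 2 → ℂ, LinearIndependent ℚ z → HyperLinLiouville z → SB 2 z) :
    DarkHyperPairSchanuel := by
  intro t ρ hρ ht _ _ _
  have hsc := hyperPair_scope (transcendental_ne_zero ht) hρ
  exact h _ hsc.1 hsc.2

/-- **Level 2 of A₄ʰ ⟺ the dark hyper pairs** (mod `hW`, `hlm`, `hX`). -/
theorem hyperLiouvilleSchanuel_two_iff_darkHyper (hW : WMeasure) (hlm : W78LogMeasure)
    (hX : ExplicitRatExpApprox) :
    (∀ z : Fin 2 → ℂ, LinearIndependent ℚ z → HyperLinLiouville z → SB 2 z) ↔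
      DarkHyperPairSchanuel :=
  ⟨darkHyper_of_hyperLiouvilleSchanuel_two,
    fun hD z hz hH => hyperLiouvilleSchanuel_two_of_darkHyper hW hlm hX hD z hz hH⟩

/-- **Level 2 of A₄ʰ from the INSTRUMENTABLE leaf** (mod `hW`, `hlm`, `hX`): `DarkWeakMeasure`
decides every ℚ-free hyper-Liouville PAIR. -/
theorem hyperLiouvilleSchanuel_two_of_darkWeakMeasure (hW : WMeasure) (hlm : W78LogMeasure)
    (hX : ExplicitRatExpApprox) (hD : DarkWeakMeasure) (z : Fin 2 → ℂ)
    (hz : LinearIndependent ℚ z) (hH : HyperLinLiouville z) : SB 2 z :=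
  hyperLiouvilleSchanuel_two_of_darkHyper hW hlm hX (darkHyper_of_darkWeakMeasure hD) z hz hH

/-- Levels 0 and 1 of A₄ʰ (and of A₄ᵈ) are vacuous / trivial. -/
theorem not_hyperLinLiouville_one {z : Fin 1 → ℂ} (hz : LinearIndependent ℚ z) :
    ¬ HyperLinLiouville z :=
  fun h => not_linLiouville_one hz h.linLiouville

/-- §17h. WHY A₄ʰ IS STRICTLY MORE ATTACKABLE THAN A₃: hyper-Liouville extraction against a: auxiliary statement `sb_zero` (lens 6 gen 9 node, ported verbatim). -/
theorem sb_zero (z : Fin 0 → ℂ) : SB 0 z := by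
  change ((0 : ℕ) : Cardinal) ≤ _
  rw [Nat.cast_zero]
  exact zero_le

/-- **A₄ʰ up to level 2 from the leaves** (mod `hW`, `hlm`, `hX`, `DarkWeakMeasure`). -/
theorem hyperLiouvilleSchanuel_le_two_of_darkWeakMeasure (hW : WMeasure) (hlm : W78LogMeasure)
    (hX : ExplicitRatExpApprox) (hD : DarkWeakMeasure) {n : ℕ} (hn : n ≤ 2) (z : Fin n → ℂ)
    (hz : LinearIndependent ℚ z) (hH : HyperLinLiouville z) : SB n z := by
  rcases n with _ | _ | _ | n
  · exact sb_zero z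
  · exact absurd hH (not_hyperLinLiouville_one hz)
  · exact hyperLiouvilleSchanuel_two_of_darkWeakMeasure hW hlm hX hD z hz hH
  · omega

/-- `π`, `e` (mod NW), `e^β` for `β ∈ ℚ̄*` (mod `hW`), non-zero logarithms of algebraic numbers
(mod `hlm`) all have weak measures — through their (stronger) polynomial measures of §7. -/
theorem weakMeasure_pi : WeakMeasure (Real.pi : ℂ) := PolyMeasure.weakMeasure polyMeasure_pi

/-- §Where WeakMeasure is already available (instances of the lever): auxiliary statement `weakMeasure_exp_one_of_NW` (lens 6 gen 9 node, ported verbatim). -/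
theorem weakMeasure_exp_one_of_NW (hNW : NWMeasure) : WeakMeasure (cexp 1) :=
  PolyMeasure.weakMeasure (polyMeasure_exp_one_of_NW hNW)

/-- §Where WeakMeasure is already available (instances of the lever): auxiliary statement `weakMeasure_exp_of_W` (lens 6 gen 9 node, ported verbatim). -/
theorem weakMeasure_exp_of_W (hW : WMeasure) {β : ℂ} (hβ : IsAlgebraic ℚ β) (hβ0 : β ≠ 0) :
    WeakMeasure (cexp β) :=
  PolyMeasure.weakMeasure (polyMeasure_exp_of_W hW hβ hβ0)

/-- §Where WeakMeasure is already available (instances of the lever): auxiliary statement `weakMeasure_log_of_W78` (lens 6 gen 9 node, ported verbatim). -/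
theorem weakMeasure_log_of_W78 (hlm : W78LogMeasure) {lam : ℂ} (h0 : lam ≠ 0)
    (halg : IsAlgebraic ℚ (cexp lam)) : WeakMeasure lam :=
  PolyMeasure.weakMeasure (polyMeasure_log_of_W78 hlm h0 halg)

end HyperCell

end Summit.Schanuel.Schanuel.Theorems.RootDecomp1KHyper
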